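import Literature.MathematicalPhysics.QuantumFieldTheory.Balaban1983to89.Node00.Record12BgRowTopDomain
import Literature.MathematicalPhysics.QuantumFieldTheory.Balaban1983to89.B15DeterminingSetsB
import Literature.MathematicalPhysics.QuantumFieldTheory.Balaban1983to89.Node00.DomainsOfSeq

/-!
# NODE 00 — ROW P11, (E1) variant (iii-b) §7′: PRINT'S DATA HYPOTHESIS (7) OF [15] READ ON PRINT'S `Λ_j` — the (7) field spliced along a BOND SET (`Sect2.mixedFieldB`),
# print's `Λ_n`-plaquettes (`Sect2.lamPlaqs`: touching `Γ_n`, NO corner in `Ω_{n+1}^{(n)}` below the top), the data predicates `Sect2.DataSmall7Lam` ∕ `Sect2.DataSmall7LamTop`,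
# and their dictionary with the landed (b)-side predicates of `Record12BgRowMixed` §1∕§6∕§7 and `Record12BgRowTopDomain` §3

statement-level skeleton of published theorems with citation tags; proofs where landed; nothing here is a claim about the Yang–Mills mass gap

Cell `pub-ymgap`, seat `pub-ymgap-node00-def-Y` generation 30 (NODE 00 definer lineage), CLAIM BOARD (iii-b) v2 row §7′ (dag-lead WORDS 292 (2); `--kind definition --supports
stmt-QuantumFields-20541`, helper, count-neutral).  Rulings of record: director-ym №338 (the additive stages of WORKPLAN-IIIB 27c850bec22d4efe), ★★★ №339 = THE (4b) FORK RULED (α),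
consequence (ii) «ADD §7′ = `Record12BgRowMixed′` twin: inward connectors OUT of the splice set in `Sect2.mixedField` :63 and the level-0 clause; one-deep-corner plaquettes OUT of
`Sect2.printedPlaqs` :543 ∕ `printedPlaqsTop`» and (iv) «every print twin's docstring quotes the (α) sentence with page»; RR-2 g23 census ADDENDUM A1 (INBOX l.32643; the two (b)-sites of
the data side: splice set `Record12BgRowTopDomain` :216 ∕ `Record12BgRowMixed` :63, range `Record12BgRowMixed` :537–544); lit-balaban iface-1 (4b) ANSWER OF RECORD (l.32666).  Names of
record it builds on: RR-2's F0a `B15DeterminingSetsB` (`spliceAtB`, `lamBondsSeq`, `bondsDet`, p765193).  [15] = [Balaban1985Variational]; [6] = [Balaban1985RegularSpaces]; [B6] =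
[Balaban1984PropagatorsII]; [III] = [Balaban1988Convergent].

THE (α) SENTENCE (№339, verbatim print).  [Balaban1984PropagatorsII] p. 224 L10–16: *"If Ω ⊂ T_η, then we denote by Ω also the set of bonds ⋃_{x∈Ω} st(x) = {bonds b ⊂ T_η: at least one
end-point of b belongs to Ω}. Let us define Λ_j = Ω_j^{(j)} ∖ Ω_{j+1}^{(j)}, j = 1, …, k − 1, Λ_k = Ω_k^{(k)}, Λ₀ = Ω₁ᶜ (2.3) for the sets of sites and the sets of bonds"* — `Λ_j` as a BOND
set is the DIFFERENCE `st(Ω_j^{(j)}) ∖ st(Ω_{j+1}^{(j)})`: an INWARD CONNECTOR (one end-point in `Γ_j^{(j)}`, the other in `Ω_{j+1}^{(j)}`) belongs to no `Λ_j`.  [Balaban1985Variational]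
p. 278 L20–33 (the data hypothesis and its boundary rule): *"we assume that |(∂V)(p′) − 1| < ε₁ for p′ ∈ 𝔅_k (7) … For some j between 0 and k p′ ∈ Λ_j. If p′ ⊂ Λ_j, i.e. all four
vertices of p′ belong to Λ_j, then … all four bonds of the boundary ∂p′ belong to Λ_j and we have (∂V)(p′) = V(∂p′). If p′ intersects the boundary of Λ_j, then some bonds b do not belong
to Λ_j and we replace V_b by V̄_b in the above equality. For example if p′ = ⟨x,y⟩∪⟨y,z⟩∪⟨z,w⟩∪⟨w,x⟩ and ⟨y,z⟩ do[es] not belong to Λ_j, then it means that y, z ∈ Λ_{j−1} and we define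
(∂V)(p′) = V(x,y)V̄(y,z)V(z,w)V(w,x)"* (glyph «Λ_{j−1}» settled on the scan by lit-balaban lead, l.32661).

READING UNDER (α) (this file's; pages above, nothing else).  A non-`Λ_j` bond of a (7)-plaquette lies OUTWARD («y, z ∈ Λ_{j−1}»): `(∂V)(p′)` is DEFINED exactly for the `j`-plaquettes
meeting `Γ_j^{(j)}` NONE of whose four corners lies in `Ω_{j+1}^{(j)}` (a corner there makes its two bonds inward connectors or bonds inside `Ω_{j+1}`, which are in no `Λ` and carry no
`V̄` either) — `Sect2.lamPlaqs Ω k j` below; at `j = 0` this is «p′ ⊂ Λ₀ = Ω₁ᶜ» (`plaqInside`), at the top `j = k` every plaquette meeting `Ω_k^{(k)}` (print has no `Ω_{k+1}`; the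
tree's index may carry junk there, whence the guard `j < k →`, the guard of `lamBondsSeq`).  On such a plaquette the (7) field reads `V = W_j` on the `Λ_j`-bonds and `V̄ =` the one-step
average of `W_{j−1}` on the bonds with both ends in the finer region: `Sect2.mixedFieldB av (lamBondsSeq Ω k j) (W j) (W (j−1))`.  CONSEQUENCE typed here (★ `Sect2.plaqHol_mixedFieldB_
lamBondsSeq_eq`): on a `Λ_j`-plaquette NO bond has a deep end-point, so the (b)-splice (`Sect2.mixedField`, splice set `bondsOf (genSet …)` = `Λ_j`-bonds PLUS the inward connectors) and
print's splice give THE SAME plaquette variable — the two (b)-sites of ADDENDUM A1 differ from print ONLY through the RANGE; and print's range is the tree's `Sect2.outerPlaqs` of §6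
(HYP-AUDIT-13 H6 ∕ NOTE-7-INNER) for an index with `Ω_{k+1} = ∅` (`Sect2.lamPlaqs_eq_outerPlaqs`; r11's `Seq.Ω_off` gives this at the record), so ★★ `Sect2.dataSmall7Lam_iff_outer`:
print's (7) under (α) IS `Sect2.DataSmall7Outer` for saturated sequences in the standing range — a landed predicate, whose named fact `VariationalThm1RegSepOuter` (§6) differs from the
print-datum fact only on the CONSTRAINT side (its fibre `IsMinimizer … (genSet s.Ω k)` is reading (b); the fibre twin is Stage 1's, not this file's).

HONESTY GUARD (№338 (5), verbatim frame).  This module is the print-datum twin of the DATA SIDE of `Record12BgRowMixed` §1∕§7 and `Record12BgRowTopDomain` §3 (FLAG №16 ∕ LOCATE-HSEAM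
5d3298b8d191f169, text widened by №339: «… on the constraint side AND the (7) data side»); the (b)-instances `Sect2.mixedField`, `Sect2.printedPlaqs`, `Sect2.DataSmall7P`,
`Sect2.printedPlaqsTop`, `Sect2.DataSmall7PTop` (and §6's `outerPlaqs` ∕ `DataSmall7Outer`) stay landed and true on their own text and keep HYP-AUDIT-13's docstring (:531–534); NOTHING landed
is edited; no displayed premise of any consumer is deleted or weakened here (this file has none).  Every declaration is NEW; `Sect2.mixedField` IS `Sect2.mixedFieldB` at `bondsOf S` by `rfl`
(`Sect2.mixedField_eq_mixedFieldB`); the range relations are inclusions∕equalities with their hypotheses displayed (`Ω (k+1) = ∅`; block saturation `hsat` and the standing range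
`k ≤ m + K` for the field dictionary — the hypotheses of `Node00/DomainsOfSeq` :219 and of F0b's `mem_lamBondsSeq_iff_lamBond`).  Bookkeeping only: nothing of [15]∕[6]∕[B6]∕[III] asserted;
no named fact re-typed here (Stage 1); K0⁷ stub 1 NOT closed; N07 NOT discharged; counts unmoved; one finite `𝕋⁴` programme at fixed `ε` — NOT continuum ∕ ℝ⁴ ∕ OS ∕ mass gap ∕ Clay.
No `sorry`, no `axiom`, no `instance`, no `notation`.

CONTENTS.  §1 `Sect2.mixedFieldB` (def) + `_of_mem ∕ _of_not_mem`, ★ `Sect2.mixedField_eq_mixedFieldB` (`rfl`), `Sect2.mixedFieldB_lamBondsSeq_of_le` (top level: the two fields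
coincide).  §2 `Sect2.lamPlaqs` (def), `mem_lamPlaqs_iff`, `lamPlaqs_subset_plaqsOf`, `lamPlaqs_of_lt` (= `outerPlaqs`), `lamPlaqs_of_le`, ★ `lamPlaqs_eq_outerPlaqs` (`Ω (k+1) = ∅`),
`lamPlaqs_subset_printedPlaqs` (+ `_of_lt`), `not_mem_lamPlaqs_of_corner` (№339 (ii): one-deep-corner plaquettes are OUT), `lamPlaqs_zero_subset_plaqInside`, `lamPlaqs_zero_eq_plaqInside`
(level 0 = «p′ ⊂ Λ₀»).  §3 `mem_pts_iff_blockOf_mem_pts_of_saturated` (the two spellings of «deep» under saturation), `Sect2.mixedFieldB_lamBondsSeq_eq_of_not_deep`,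
★ `Sect2.plaqHol_mixedFieldB_lamBondsSeq_eq` (on a `Λ`-plaquette the two splices give one plaquette variable), `plaqSmallOn_lamPlaqs_mixedFieldB_iff`.  §4 `Sect2.DataSmall7Lam` (def) + `.zero ∕ .succ ∕ .of_le ∕ .of_spliceAtB`, ★★ `Sect2.dataSmall7Lam_iff_outer`, `Sect2.DataSmall7Outer.toLam`,
`Sect2.DataSmall7Lam.toOuter`, `Sect2.DataSmall7P.toLam`, `Sect2.DataSmall7.toLam`.  §5 top domain `Ω₀`: `Sect2.lamPlaqsTop` (def) + `_subset ∕ _univ ∕ _mono ∕ _subset_printedPlaqsTop`,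
`Sect2.DataSmall7LamTop` (def) + `.zero ∕ .succ ∕ .of_le ∕ .anti ∕ .of_spliceAtB`, `Sect2.DataSmall7Lam.toTop`, `Sect2.dataSmall7LamTop_univ_iff`, ★ `Sect2.DataSmall7PTop.toLamTop`.
-/

noncomputable section

namespace Literature.MathematicalPhysics.QuantumFieldTheory.Balaban1983to89.Node00

open B15DeterminingSets B15DeterminingSetsB
open B5Eq118OneStroke (iterBlockOf iterBlockOf_succ)

variable {P : Params} {G : Type*} [GaugeGroup G]

/-! ## §1  The (7) field spliced along a BOND SET -/

/-- **PRINT'S (7) FIELD AT LEVEL `m+1` ALONG A BOND SET `𝔅`**: the datum `W_{m+1}` on the bonds of `𝔅`, print's `V̄` — the one-step average of the finer datum `W_m` — on every other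
level-`(m+1)` bond («we replace V_b by V̄_b … y, z ∈ Λ_{j−1}»).  Print's instance is `𝔅 := lamBondsSeq Ω k (m+1)` (the `Λ_{m+1}`-bonds, (α)); the landed `Sect2.mixedField av S` is the
instance `𝔅 := bondsOf S` (reading (b)) by `rfl`. [cite: Balaban1985Variational, (7) p.278 L26–33; Balaban1984PropagatorsII, (2.3) p.224] -/
def Sect2.mixedFieldB (av : ∀ j, Averaging P j G) {m : ℕ} (𝔅 : Set (PBond P (m + 1))) (Wn : GaugeField P (m + 1) G) (Wm : GaugeField P m G) :
    GaugeField P (m + 1) G :=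
  spliceAtB 𝔅 Wn ((av m).avg Wm)

/-- On a bond of `𝔅` the (7) field is the datum. [cite: Balaban1985Variational, (7) p.278 (bookkeeping)] -/
theorem Sect2.mixedFieldB_of_mem (av : ∀ j, Averaging P j G) {m : ℕ} {𝔅 : Set (PBond P (m + 1))} (Wn : GaugeField P (m + 1) G) (Wm : GaugeField P m G)
    {b : PBond P (m + 1)} (hb : b ∈ 𝔅) : Sect2.mixedFieldB av 𝔅 Wn Wm b = Wn b :=
  spliceAtB_of_mem Wn _ hb

/-- Off `𝔅` the (7) field is the averaged finer datum `V̄`. [cite: Balaban1985Variational, (7) p.278 (bookkeeping)] -/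
theorem Sect2.mixedFieldB_of_not_mem (av : ∀ j, Averaging P j G) {m : ℕ} {𝔅 : Set (PBond P (m + 1))} (Wn : GaugeField P (m + 1) G) (Wm : GaugeField P m G)
    {b : PBond P (m + 1)} (hb : b ∉ 𝔅) : Sect2.mixedFieldB av 𝔅 Wn Wm b = (av m).avg Wm b :=
  spliceAtB_of_not_mem Wn _ hb

/-- ★ READING (b) IS THE INSTANCE `bondsOf S`, definitionally: `Sect2.mixedField av S = Sect2.mixedFieldB av (bondsOf S)`. [cite: Balaban1985Variational, (7) p.278 (bookkeeping)] -/
theorem Sect2.mixedField_eq_mixedFieldB (av : ∀ j, Averaging P j G) {m : ℕ} (S : Set (Site P (m + 1))) (Wn : GaugeField P (m + 1) G) (Wm : GaugeField P m G) :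
    Sect2.mixedField av S Wn Wm = Sect2.mixedFieldB av (bondsOf S) Wn Wm := rfl

/-- AT THE TOP LEVEL the two splice sets coincide (`Λ_k`'s bonds = the bonds meeting `Γ_k = Ω_k^{(k)}`, `B15DeterminingSetsB.lamBondsSeq_of_le`), so print's (7) field IS the (b) field there.
[cite: Balaban1984PropagatorsII, (2.3) p.224; Balaban1985Variational, (7) p.278] -/
theorem Sect2.mixedFieldB_lamBondsSeq_of_le (av : ∀ j, Averaging P j G) (Ω : ℕ → Set (Site P 0)) {k m : ℕ} (hkm : k ≤ m + 1) (Wn : GaugeField P (m + 1) G) (Wm : GaugeField P m G) :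
    Sect2.mixedFieldB av (lamBondsSeq Ω k (m + 1)) Wn Wm = Sect2.mixedField av (genSet Ω k (m + 1)) Wn Wm := by
  rw [Sect2.mixedField_eq_mixedFieldB, lamBondsSeq_of_le Ω k hkm]

/-! ## §2  Print's `Λ_n`-plaquettes: touching `Γ_n`, no corner in `Ω_{n+1}^{(n)}` below the top -/

/-- **★ PRINT'S (7) PLAQUETTES AT LEVEL `n` UNDER (α)** — the `n`-plaquettes `p′ ∈ Λ_n` for which p. 278 DEFINES `(∂V)(p′)`: meeting `Γ_n^{(n)}` (`plaqsOf (genSet Ω k n)`, [6] p.77's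
convention) and, below the top level, with NO corner in `Ω_{n+1}^{(n)}` (`pts n (Ω (n+1))`) — a corner there would make its two bonds inward connectors (in no `Λ`, (2.3)) or bonds inside
`Ω_{n+1}`; every other bond of such a `p′` is a `Λ_n`-bond or has both ends in the finer region («y, z ∈ Λ_{j−1}»).  At `n = 0`: «p′ ⊂ Λ₀ = Ω₁ᶜ»; at `n = k`: every plaquette meeting
`Ω_k^{(k)}` (the guard `n < k →` is `lamBondsSeq`'s; print has no `Ω_{k+1}`).  One-deep-corner plaquettes — KEPT by the (b)-range `Sect2.printedPlaqs` (HYP-AUDIT-13 CONCORD) — are OUT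
(№339 (ii)). [cite: Balaban1985Variational, (7) p.278 L20–33; Balaban1984PropagatorsII, (2.3) p.224; Balaban1985RegularSpaces, (1.5) p.77] -/
def Sect2.lamPlaqs (Ω : ℕ → Set (Site P 0)) (k n : ℕ) : Set (Plaq P n) :=
  {p | p ∈ B8Eq17ClassAkV1.plaqsOf (genSet Ω k n) ∧
    (n < k → p.src ∉ pts n (Ω (n + 1)) ∧ p.src.shift p.μ ∉ pts n (Ω (n + 1)) ∧ p.src.shift p.ν ∉ pts n (Ω (n + 1)) ∧
      (p.src.shift p.μ).shift p.ν ∉ pts n (Ω (n + 1)))}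

section LamPlaqs

variable (Ω : ℕ → Set (Site P 0)) (k : ℕ)

/-- Unfolding of `Sect2.lamPlaqs`. [cite: Balaban1985Variational, (7) p.278 (bookkeeping)] -/
theorem Sect2.mem_lamPlaqs_iff {n : ℕ} (p : Plaq P n) :
    p ∈ Sect2.lamPlaqs Ω k n ↔ p ∈ B8Eq17ClassAkV1.plaqsOf (genSet Ω k n) ∧
      (n < k → p.src ∉ pts n (Ω (n + 1)) ∧ p.src.shift p.μ ∉ pts n (Ω (n + 1)) ∧ p.src.shift p.ν ∉ pts n (Ω (n + 1)) ∧
        (p.src.shift p.μ).shift p.ν ∉ pts n (Ω (n + 1))) :=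
  Iff.rfl

/-- Print's (7) plaquettes meet `Γ_n`. [cite: Balaban1985Variational, (7) p.278 (bookkeeping)] -/
theorem Sect2.lamPlaqs_subset_plaqsOf (n : ℕ) : Sect2.lamPlaqs Ω k n ⊆ B8Eq17ClassAkV1.plaqsOf (genSet Ω k n) := fun _ hp => hp.1

/-- BELOW THE TOP print's (7) plaquettes are §6's OUTER plaquettes (HYP-AUDIT-13 H6 ∕ NOTE-7-INNER: no corner in `Ω_{n+1}`). [cite: Balaban1985Variational, (7) p.278 L26–33] -/
theorem Sect2.lamPlaqs_of_lt {n : ℕ} (hn : n < k) : Sect2.lamPlaqs Ω k n = Sect2.outerPlaqs Ω k n := by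
  ext p
  simp only [Sect2.lamPlaqs, Sect2.outerPlaqs, hn, forall_true_left, Set.mem_setOf_eq]

/-- AT AND ABOVE THE TOP there is no exclusion: every plaquette meeting `Γ_n` (at `n = k`: meeting `Ω_k^{(k)}`; above `k`: none). [cite: Balaban1985Variational, (7) p.278 L20–26] -/
theorem Sect2.lamPlaqs_of_le {n : ℕ} (hn : k ≤ n) : Sect2.lamPlaqs Ω k n = B8Eq17ClassAkV1.plaqsOf (genSet Ω k n) := by
  ext p
  simp only [Sect2.lamPlaqs, not_lt.mpr hn, IsEmpty.forall_iff, and_true, Set.mem_setOf_eq]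

/-- ★ **FOR AN INDEX WITH `Ω_{k+1} = ∅`** (print; r11's `Seq.Ω_off` at the record) print's (7) plaquettes ARE §6's outer plaquettes AT EVERY LEVEL. [cite: Balaban1985Variational, (7) p.278 L20–33] -/
theorem Sect2.lamPlaqs_eq_outerPlaqs (hΩ : Ω (k + 1) = ∅) (n : ℕ) : Sect2.lamPlaqs Ω k n = Sect2.outerPlaqs Ω k n := by
  rcases Nat.lt_or_ge n k with hn | hn
  · exact Sect2.lamPlaqs_of_lt Ω k hn
  · rcases hn.eq_or_lt with rfl | hkn
    · ext p
      simp only [Sect2.lamPlaqs, Sect2.outerPlaqs, lt_irrefl, IsEmpty.forall_iff, and_true, hΩ, Set.mem_setOf_eq, mem_pts, Set.mem_empty_iff_false,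
        not_false_eq_true, and_self]
    · ext p
      have he : B8Eq17ClassAkV1.plaqsOf (genSet Ω k n) = ∅ := by
        ext q
        simp only [B8Eq17ClassAkV1.plaqsOf, genSet, gammaRegion_of_gt Ω hkn, mem_pts, Set.mem_empty_iff_false, or_self, Set.mem_setOf_eq]
      simp only [Sect2.lamPlaqs, Sect2.outerPlaqs, Set.mem_setOf_eq, he, Set.mem_empty_iff_false, false_and]

/-- Print's (7) plaquettes lie in the (b)-range `Sect2.printedPlaqs` (the CONCORD range keeps, in addition, the one-deep-corner plaquettes), for an index with `Ω_{k+1} = ∅`.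
[cite: Balaban1985Variational, (7) p.278 L20–33] -/
theorem Sect2.lamPlaqs_subset_printedPlaqs (hΩ : Ω (k + 1) = ∅) (n : ℕ) : Sect2.lamPlaqs Ω k n ⊆ Sect2.printedPlaqs Ω k n := by
  rw [Sect2.lamPlaqs_eq_outerPlaqs Ω k hΩ n]
  exact Sect2.outerPlaqs_subset_printedPlaqs Ω k n

/-- Below the top the same inclusion needs no hypothesis. [cite: Balaban1985Variational, (7) p.278 (bookkeeping)] -/
theorem Sect2.lamPlaqs_subset_printedPlaqs_of_lt {n : ℕ} (hn : n < k) : Sect2.lamPlaqs Ω k n ⊆ Sect2.printedPlaqs Ω k n := by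
  rw [Sect2.lamPlaqs_of_lt Ω k hn]
  exact Sect2.outerPlaqs_subset_printedPlaqs Ω k n

/-- **№339 (ii): A PLAQUETTE WITH A CORNER IN `Ω_{n+1}^{(n)}` (below the top) IS NOT A (7) PLAQUETTE** — in particular the one-deep-corner plaquettes the (b)-range keeps.
[cite: Balaban1984PropagatorsII, (2.3) p.224; Balaban1985Variational, (7) p.278 L26–33] -/
theorem Sect2.not_mem_lamPlaqs_of_corner {n : ℕ} (hn : n < k) {p : Plaq P n}
    (hc : p.src ∈ pts n (Ω (n + 1)) ∨ p.src.shift p.μ ∈ pts n (Ω (n + 1)) ∨ p.src.shift p.ν ∈ pts n (Ω (n + 1)) ∨ (p.src.shift p.μ).shift p.ν ∈ pts n (Ω (n + 1))) :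
    p ∉ Sect2.lamPlaqs Ω k n := by
  intro hp
  obtain ⟨h1, h2, h3, h4⟩ := hp.2 hn
  rcases hc with h | h | h | h
  · exact h1 h
  · exact h2 h
  · exact h3 h
  · exact h4 h

/-- AT LEVEL 0 (for `k ≥ 1`) the (7) plaquettes lie INSIDE `Γ₀ = Ω₁ᶜ` — «p′ ⊂ Λ₀», the level-0 clause of §1's `Sect2.DataSmall7` (`plaqInside (genSet Ω k 0)`).
[cite: Balaban1985Variational, (7) p.278 L24–26; Balaban1988Convergent, (2.2) p.255] -/
theorem Sect2.lamPlaqs_zero_subset_plaqInside (hk : 0 < k) : Sect2.lamPlaqs Ω k 0 ⊆ plaqInside (genSet Ω k 0) := by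
  intro p hp
  obtain ⟨h1, h2, h3, h4⟩ := hp.2 hk
  have hΓ : ∀ y : Site P 0, y ∉ pts 0 (Ω (0 + 1)) → y ∈ genSet Ω k 0 := fun y hy => by
    rw [genSet, mem_pts, gammaRegion_zero Ω hk]
    exact hy
  exact ⟨hΓ _ h1, hΓ _ h2, hΓ _ h3, hΓ _ h4⟩

/-- Conversely every plaquette inside `Γ₀` is a level-0 (7) plaquette (for `k ≥ 1`): the level-0 range IS `plaqInside (genSet Ω k 0)`. [cite: Balaban1985Variational, (7) p.278 L24–26] -/
theorem Sect2.lamPlaqs_zero_eq_plaqInside (hk : 0 < k) : Sect2.lamPlaqs Ω k 0 = plaqInside (genSet Ω k 0) := by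
  refine Set.Subset.antisymm (Sect2.lamPlaqs_zero_subset_plaqInside Ω k hk) fun p hp => ?_
  obtain ⟨h1, h2, h3, h4⟩ := hp
  have hΓ : ∀ y : Site P 0, y ∈ genSet Ω k 0 → y ∉ pts 0 (Ω (0 + 1)) := fun y hy => by
    rw [genSet, mem_pts, gammaRegion_zero Ω hk] at hy
    exact hy
  exact ⟨Or.inl h1, fun _ => ⟨hΓ _ h1, hΓ _ h2, hΓ _ h3, hΓ _ h4⟩⟩

end LamPlaqs

/-! ## §3  On a `Λ`-plaquette the (b)-splice and print's splice give ONE plaquette variable -/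

section HolAgree

/-- Face-neighbour steps commute. [folklore] -/
private theorem shift_shift_comm {j : ℕ} (x : Site P j) (μ ν : Fin P.d) : (x.shift μ).shift ν = (x.shift ν).shift μ := by
  funext i
  by_cases hν : i = ν
  · subst hν
    by_cases hμ : i = μ
    · subst hμ; rfl
    · simp [Site.shift, Function.update_apply, hμ]
  · by_cases hμ : i = μ
    · subst hμ
      simp [Site.shift, Function.update_apply, hν]
    · simp [Site.shift, Function.update_apply, hμ, hν]

/-- The site-level dictionary between the two spellings of «deep»: for a `(j+1)`-block-saturated region `X` (standing range `j + 1 ≤ m + K`), a `j`-site lies in `X^{(j)}` iff its block is an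
`X^{(j+1)}`-point (`Record12BgRowMixed`'s `c ∈ pts j X` versus `B6SectADomainsV1.Domains.Deep`'s ∕ `lamBondsSeq`'s `blockOf c ∈ pts (j+1) X`). [cite: Balaban1987RG1, (0.1)–(0.3) pp.251–252] -/
theorem mem_pts_iff_blockOf_mem_pts_of_saturated {j : ℕ} (hj : j + 1 ≤ P.m + P.K) {X : Set (Site P 0)}
    (hsat : ∀ x x' : Site P 0, iterBlockOf (j + 1) x = iterBlockOf (j + 1) x' → x ∈ X → x' ∈ X) (c : Site P j) :
    c ∈ pts j X ↔ blockOf c ∈ pts (j + 1) X := by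
  rw [mem_pts, mem_pts]
  have h1 : iterBlockOf (j + 1) (embIter j c) = blockOf c := by rw [iterBlockOf_succ, iterBlockOf_embIter_eq (by omega) c]
  have h2 : iterBlockOf (j + 1) (embIter (j + 1) (blockOf c)) = blockOf c := iterBlockOf_embIter_eq hj (blockOf c)
  exact ⟨fun h => hsat _ _ (h1.trans h2.symm) h, fun h => hsat _ _ (h2.trans h1.symm) h⟩

variable (av : ∀ j, Averaging P j G) (Ω : ℕ → Set (Site P 0)) {k : ℕ}

/-- On a bond with NO deep end-point (both spellings, via saturation) membership in `Λ_{m+1}`'s bonds and in the (b) splice set coincide, so the two (7) fields take the same value.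
[cite: Balaban1984PropagatorsII, (2.3) p.224; Balaban1985Variational, (7) p.278 L26–33] -/
theorem Sect2.mixedFieldB_lamBondsSeq_eq_of_not_deep {m : ℕ} (Wn : GaugeField P (m + 1) G) (Wm : GaugeField P m G) {b : PBond P (m + 1)}
    (hs : blockOf b.src ∉ pts (m + 1 + 1) (Ω (m + 1 + 1))) (ht : blockOf b.tgt ∉ pts (m + 1 + 1) (Ω (m + 1 + 1))) :
    Sect2.mixedFieldB av (lamBondsSeq Ω k (m + 1)) Wn Wm b = Sect2.mixedField av (genSet Ω k (m + 1)) Wn Wm b := by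
  by_cases hb : b ∈ bondsOf (genSet Ω k (m + 1))
  · have hb' : b ∈ lamBondsSeq Ω k (m + 1) := ⟨hb, fun _ => ⟨hs, ht⟩⟩
    rw [Sect2.mixedFieldB_of_mem av Wn Wm hb', Sect2.mixedField_of_mem av Wn Wm hb]
  · have hb' : b ∉ lamBondsSeq Ω k (m + 1) := fun h => hb h.1
    rw [Sect2.mixedFieldB_of_not_mem av Wn Wm hb', Sect2.mixedField_of_not_mem av Wn Wm hb]

/-- ★ **ON A `Λ_{m+1}`-PLAQUETTE THE (b)-SPLICE AND PRINT'S SPLICE GIVE THE SAME PLAQUETTE VARIABLE** (below the top; `Ω_{m+2}` saturated by `(m+2)`-blocks, standing range): none of its four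
bonds has a deep end-point, so each reads `W_{m+1}` or `V̄` identically under both splice sets — ADDENDUM A1's splice-set site differs from print only off print's range.
[cite: Balaban1985Variational, (7) p.278 L26–33; Balaban1984PropagatorsII, (2.3) p.224] -/
theorem Sect2.plaqHol_mixedFieldB_lamBondsSeq_eq {m : ℕ} (hm : m + 1 + 1 ≤ P.m + P.K) (hmk : m + 1 < k)
    (hsat : ∀ x x' : Site P 0, iterBlockOf (m + 1 + 1) x = iterBlockOf (m + 1 + 1) x' → x ∈ Ω (m + 1 + 1) → x' ∈ Ω (m + 1 + 1))
    (Wn : GaugeField P (m + 1) G) (Wm : GaugeField P m G) {p : Plaq P (m + 1)} (hp : p ∈ Sect2.lamPlaqs Ω k (m + 1)) :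
    GaugeField.plaqHol (Sect2.mixedFieldB av (lamBondsSeq Ω k (m + 1)) Wn Wm) p = GaugeField.plaqHol (Sect2.mixedField av (genSet Ω k (m + 1)) Wn Wm) p := by
  obtain ⟨h1, h2, h3, h4⟩ := hp.2 hmk
  have hd : ∀ c : Site P (m + 1), c ∉ pts (m + 1) (Ω (m + 1 + 1)) → blockOf c ∉ pts (m + 1 + 1) (Ω (m + 1 + 1)) :=
    fun c hc h => hc ((mem_pts_iff_blockOf_mem_pts_of_saturated hm hsat c).2 h)
  have h4' : (p.src.shift p.ν).shift p.μ ∉ pts (m + 1) (Ω (m + 1 + 1)) := by rw [← shift_shift_comm]; exact h4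
  have e1 := Sect2.mixedFieldB_lamBondsSeq_eq_of_not_deep av Ω (k := k) Wn Wm (b := ⟨p.src, p.μ⟩) (hd _ h1) (hd _ h2)
  have e2 := Sect2.mixedFieldB_lamBondsSeq_eq_of_not_deep av Ω (k := k) Wn Wm (b := ⟨p.src.shift p.μ, p.ν⟩) (hd _ h2) (hd _ h4)
  have e3 := Sect2.mixedFieldB_lamBondsSeq_eq_of_not_deep av Ω (k := k) Wn Wm (b := ⟨p.src.shift p.ν, p.μ⟩) (hd _ h3) (hd _ h4')
  have e4 := Sect2.mixedFieldB_lamBondsSeq_eq_of_not_deep av Ω (k := k) Wn Wm (b := ⟨p.src, p.ν⟩) (hd _ h1) (hd _ h3)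
  unfold GaugeField.plaqHol
  rw [e1, e2, e3, e4]

/-- Hence (7)-smallness on print's range reads the same under both splices (below the top). [cite: Balaban1985Variational, (7) p.278 L20–33] -/
theorem Sect2.plaqSmallOn_lamPlaqs_mixedFieldB_iff {m : ℕ} (hm : m + 1 + 1 ≤ P.m + P.K) (hmk : m + 1 < k)
    (hsat : ∀ x x' : Site P 0, iterBlockOf (m + 1 + 1) x = iterBlockOf (m + 1 + 1) x' → x ∈ Ω (m + 1 + 1) → x' ∈ Ω (m + 1 + 1))
    (δ : ℝ) (Wn : GaugeField P (m + 1) G) (Wm : GaugeField P m G) :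
    PlaqSmallOn (Sect2.lamPlaqs Ω k (m + 1)) δ (Sect2.mixedFieldB av (lamBondsSeq Ω k (m + 1)) Wn Wm) ↔
      PlaqSmallOn (Sect2.lamPlaqs Ω k (m + 1)) δ (Sect2.mixedField av (genSet Ω k (m + 1)) Wn Wm) := by
  constructor
  · intro h p hp
    rw [← Sect2.plaqHol_mixedFieldB_lamBondsSeq_eq av Ω hm hmk hsat Wn Wm hp]
    exact h p hp
  · intro h p hp
    rw [Sect2.plaqHol_mixedFieldB_lamBondsSeq_eq av Ω hm hmk hsat Wn Wm hp]
    exact h p hp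

end HolAgree

/-! ## §4  Print's data hypothesis (7) on `Λ`: `Sect2.DataSmall7Lam`, and its dictionary with §6 ∕ §7 ∕ §1 of `Record12BgRowMixed` -/

section DataLam

variable {av : ∀ j, Averaging P j G} {Ω : ℕ → Set (Site P 0)} {k : ℕ} {δ δ' : ℕ → ℝ} {W : MSField P G}

variable (av Ω k δ W) in
/-- **★ PRINT'S DATA HYPOTHESIS (7) UNDER (α), per scale** («|(∂V)(p′) − 1| < ε₁ for p′ ∈ 𝔅_k», thresholds `δ_n` at scale `n`): level 0 — the datum `W 0` on the plaquettes «⊂ Λ₀»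
(`Sect2.lamPlaqs Ω k 0`); level `m+1 ≤ k` — the (7) field SPLICED ALONG `Λ_{m+1}`'S BONDS (`Sect2.mixedFieldB av (lamBondsSeq Ω k (m+1))`: `W (m+1)` on `Λ_{m+1}`, `V̄` = the average of
`W m` elsewhere) on print's `Λ_{m+1}`-plaquettes (`Sect2.lamPlaqs Ω k (m+1)`: no corner in `Ω_{m+2}^{(m+1)}`).  Typed over a concrete (2.18) index `Ω` with `k` levels.
-- TODO(general form): (7) is printed for an arbitrary admissible `𝔅_k = ⋃ Λ_j` of [6] Sect. A and ONE threshold `ε₁`; here `Λ_j = lamBondsSeq Ω k j` of a (2.18) index, thresholds per scale.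
[cite: Balaban1985Variational, (7) p.278 L20–33; Balaban1984PropagatorsII, (2.3) p.224; Balaban1985RegularSpaces, (1.3)–(1.8) p.77; Balaban1988Convergent, (2.10)–(2.12) p.256] -/
def Sect2.DataSmall7Lam : Prop :=
  PlaqSmallOn (Sect2.lamPlaqs Ω k 0) (δ 0) (W 0) ∧
    ∀ m, m + 1 ≤ k → PlaqSmallOn (Sect2.lamPlaqs Ω k (m + 1)) (δ (m + 1)) (Sect2.mixedFieldB av (lamBondsSeq Ω k (m + 1)) (W (m + 1)) (W m))

/-- The level-0 clause. [cite: Balaban1985Variational, (7) p.278 (bookkeeping)] -/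
theorem Sect2.DataSmall7Lam.zero (h : Sect2.DataSmall7Lam av Ω k δ W) : PlaqSmallOn (Sect2.lamPlaqs Ω k 0) (δ 0) (W 0) := h.1

/-- The level-`(m+1)` clause, in the `spliceAtB` spelling. [cite: Balaban1985Variational, (7) p.278 (bookkeeping)] -/
theorem Sect2.DataSmall7Lam.succ (h : Sect2.DataSmall7Lam av Ω k δ W) {m : ℕ} (hm : m + 1 ≤ k) :
    PlaqSmallOn (Sect2.lamPlaqs Ω k (m + 1)) (δ (m + 1)) (spliceAtB (lamBondsSeq Ω k (m + 1)) (W (m + 1)) ((av m).avg (W m))) := h.2 m hm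

/-- (7) on `Λ` FROM ITS TWO CLAUSES (`spliceAtB` spelling). [cite: Balaban1985Variational, (7) p.278 (bookkeeping)] -/
theorem Sect2.DataSmall7Lam.of_spliceAtB (h0 : PlaqSmallOn (Sect2.lamPlaqs Ω k 0) (δ 0) (W 0))
    (hsucc : ∀ m, m + 1 ≤ k → PlaqSmallOn (Sect2.lamPlaqs Ω k (m + 1)) (δ (m + 1)) (spliceAtB (lamBondsSeq Ω k (m + 1)) (W (m + 1)) ((av m).avg (W m)))) :
    Sect2.DataSmall7Lam av Ω k δ W := ⟨h0, hsucc⟩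

/-- Weakening the thresholds. [cite: Balaban1985Variational, (7) p.278 (bookkeeping)] -/
theorem Sect2.DataSmall7Lam.of_le (h : Sect2.DataSmall7Lam av Ω k δ W) (hδ : ∀ n, n ≤ k → δ n ≤ δ' n) : Sect2.DataSmall7Lam av Ω k δ' W :=
  ⟨fun p hp => (h.1 p hp).trans_le (hδ 0 (Nat.zero_le _)), fun m hm p hp => (h.2 m hm p hp).trans_le (hδ (m + 1) hm)⟩

/-- ★★ **PRINT'S (7) UNDER (α) IS §6's `Sect2.DataSmall7Outer`** for an index with `Ω_{k+1} = ∅` whose regions `Ω_j` (`2 ≤ j ≤ k`) are unions of `j`-blocks, in the standing range `k ≤ m + K`: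
the ranges coincide (`Sect2.lamPlaqs_eq_outerPlaqs`) and on them the two (7) fields give the same plaquette variables (§3).  So the (b) data side deviates from print ONLY in the surplus of
`Sect2.printedPlaqs` over `Sect2.outerPlaqs` (the one-deep-corner plaquettes) — HYP-AUDIT-13's H6 cut was print's. [cite: Balaban1985Variational, (7) p.278 L20–33; Balaban1984PropagatorsII, (2.3) p.224] -/
theorem Sect2.dataSmall7Lam_iff_outer (av : ∀ j, Averaging P j G) (Ω : ℕ → Set (Site P 0)) {k : ℕ} (hk : k ≤ P.m + P.K) (hΩ : Ω (k + 1) = ∅)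
    (hsat : ∀ (j : ℕ) (x x' : Site P 0), 1 ≤ j → j ≤ k → iterBlockOf j x = iterBlockOf j x' → x ∈ Ω j → x' ∈ Ω j) (δ : ℕ → ℝ) (W : MSField P G) :
    Sect2.DataSmall7Lam av Ω k δ W ↔ Sect2.DataSmall7Outer av Ω k δ W := by
  have hsucc : ∀ m, m + 1 ≤ k →
      (PlaqSmallOn (Sect2.lamPlaqs Ω k (m + 1)) (δ (m + 1)) (Sect2.mixedFieldB av (lamBondsSeq Ω k (m + 1)) (W (m + 1)) (W m)) ↔
        PlaqSmallOn (Sect2.outerPlaqs Ω k (m + 1)) (δ (m + 1)) (Sect2.mixedField av (genSet Ω k (m + 1)) (W (m + 1)) (W m))) := by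
    intro m hm
    rcases hm.lt_or_eq with hmk | hmk
    · rw [Sect2.plaqSmallOn_lamPlaqs_mixedFieldB_iff av Ω (by omega) hmk (fun x x' => hsat (m + 1 + 1) x x' (by omega) (by omega)) (δ (m + 1)) (W (m + 1)) (W m),
        Sect2.lamPlaqs_of_lt Ω k hmk]
    · rw [Sect2.mixedFieldB_lamBondsSeq_of_le av Ω hmk.ge, Sect2.lamPlaqs_eq_outerPlaqs Ω k hΩ]
  unfold Sect2.DataSmall7Lam Sect2.DataSmall7Outer
  rw [Sect2.lamPlaqs_eq_outerPlaqs Ω k hΩ 0]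
  exact and_congr Iff.rfl (forall_congr' fun m => forall_congr' fun hm => hsucc m hm)

/-- §6's outer-range (7) GIVES print's (7) (same hypotheses). [cite: Balaban1985Variational, (7) p.278 (bookkeeping)] -/
theorem Sect2.DataSmall7Outer.toLam (hk : k ≤ P.m + P.K) (hΩ : Ω (k + 1) = ∅)
    (hsat : ∀ (j : ℕ) (x x' : Site P 0), 1 ≤ j → j ≤ k → iterBlockOf j x = iterBlockOf j x' → x ∈ Ω j → x' ∈ Ω j) (h : Sect2.DataSmall7Outer av Ω k δ W) :
    Sect2.DataSmall7Lam av Ω k δ W :=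
  (Sect2.dataSmall7Lam_iff_outer av Ω hk hΩ hsat δ W).2 h

/-- Print's (7) GIVES §6's outer-range (7) (same hypotheses) — so §6's named fact `VariationalThm1RegSepOuter` reads print's data hypothesis (its FIBRE is still reading (b)).
[cite: Balaban1985Variational, (7) p.278 (bookkeeping)] -/
theorem Sect2.DataSmall7Lam.toOuter (hk : k ≤ P.m + P.K) (hΩ : Ω (k + 1) = ∅)
    (hsat : ∀ (j : ℕ) (x x' : Site P 0), 1 ≤ j → j ≤ k → iterBlockOf j x = iterBlockOf j x' → x ∈ Ω j → x' ∈ Ω j) (h : Sect2.DataSmall7Lam av Ω k δ W) :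
    Sect2.DataSmall7Outer av Ω k δ W :=
  (Sect2.dataSmall7Lam_iff_outer av Ω hk hΩ hsat δ W).1 h

/-- ★ §7's CONCORD-range (7) (`Sect2.DataSmall7P`, the (b) data side of record) GIVES print's (7): the record ASSUMES (7) on MORE plaquettes. [cite: Balaban1985Variational, (7) p.278 L20–33] -/
theorem Sect2.DataSmall7P.toLam (hk : k ≤ P.m + P.K) (hΩ : Ω (k + 1) = ∅)
    (hsat : ∀ (j : ℕ) (x x' : Site P 0), 1 ≤ j → j ≤ k → iterBlockOf j x = iterBlockOf j x' → x ∈ Ω j → x' ∈ Ω j) (h : Sect2.DataSmall7P av Ω k δ W) :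
    Sect2.DataSmall7Lam av Ω k δ W :=
  h.toOuter.toLam hk hΩ hsat

/-- §1's original (7) (`Sect2.DataSmall7`, all plaquettes touching `Γ_n`; level 0 inside `Γ₀`) GIVES print's (7), for `k ≥ 1`. [cite: Balaban1985Variational, (7) p.278 L20–33] -/
theorem Sect2.DataSmall7.toLam (hk : k ≤ P.m + P.K) (hk1 : 0 < k) (hΩ : Ω (k + 1) = ∅)
    (hsat : ∀ (j : ℕ) (x x' : Site P 0), 1 ≤ j → j ≤ k → iterBlockOf j x = iterBlockOf j x' → x ∈ Ω j → x' ∈ Ω j) (h : Sect2.DataSmall7 av Ω k δ W) :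
    Sect2.DataSmall7Lam av Ω k δ W :=
  (h.toOuter (by rw [← Sect2.lamPlaqs_of_lt Ω k hk1]; exact Sect2.lamPlaqs_zero_subset_plaqInside Ω k hk1)).toLam hk hΩ hsat

end DataLam

/-! ## §5  The top domain `Ω₀`: print's level-0 range cut to the plaquettes meeting `Ω₀`, and (7) for the top domain -/

section DataLamTop

variable {av : ∀ j, Averaging P j G} {Ω : ℕ → Set (Site P 0)} {Ω₀ Ω₀' : Set (Site P 0)} {k : ℕ} {δ δ' : ℕ → ℝ} {W : MSField P G}

variable (Ω Ω₀ k) in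
/-- **★ PRINT'S (7) PLAQUETTES AT LEVEL 0 FOR THE TOP DOMAIN `Ω₀`** («p′ ⊂ Λ₀», `Λ₀ ⊂ Ω₀ ∖ Ω₁`): the level-0 `Λ`-plaquettes meeting `Ω₀` — `Record12BgRowTopDomain`'s `Sect2.printedPlaqsTop` with the
one-deep-corner plaquettes OUT (№339 (ii)). `= Sect2.lamPlaqs Ω k 0` at `Ω₀ = univ`. [cite: Balaban1985Variational, (3),(7) p.278 L20–33; Balaban1985RegularSpaces, (1.5) p.77] -/
def Sect2.lamPlaqsTop : Set (Plaq P 0) :=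
  Sect2.lamPlaqs Ω k 0 ∩ B8Eq17ClassAkV1.plaqsOf Ω₀

variable (Ω Ω₀ k) in
/-- The top-domain range lies inside the level-0 range. [cite: Balaban1985Variational, (7) p.278 (bookkeeping)] -/
theorem Sect2.lamPlaqsTop_subset : Sect2.lamPlaqsTop Ω Ω₀ k ⊆ Sect2.lamPlaqs Ω k 0 := Set.inter_subset_left

variable (Ω k) in
/-- At `Ω₀ = T_η` the cut is void. [cite: Balaban1985Variational, (7) p.278 (bookkeeping)] -/
theorem Sect2.lamPlaqsTop_univ : Sect2.lamPlaqsTop Ω Set.univ k = Sect2.lamPlaqs Ω k 0 := by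
  rw [Sect2.lamPlaqsTop, B8Eq17ClassAkV1.plaqsOf_univ, Set.inter_univ]

variable (Ω k) in
/-- MONOTONE in the top domain. [cite: Balaban1985Variational, (7) p.278 (bookkeeping)] -/
theorem Sect2.lamPlaqsTop_mono (h : Ω₀' ⊆ Ω₀) : Sect2.lamPlaqsTop Ω Ω₀' k ⊆ Sect2.lamPlaqsTop Ω Ω₀ k :=
  Set.inter_subset_inter_right _ (B8Eq17ClassAkV1.plaqsOf_mono h)

variable (Ω Ω₀ k) in
/-- Print's top-domain range lies in the (b) one (`Sect2.printedPlaqsTop`), for an index with `Ω_{k+1} = ∅`. [cite: Balaban1985Variational, (7) p.278 (bookkeeping)] -/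
theorem Sect2.lamPlaqsTop_subset_printedPlaqsTop (hΩ : Ω (k + 1) = ∅) : Sect2.lamPlaqsTop Ω Ω₀ k ⊆ Sect2.printedPlaqsTop Ω Ω₀ k :=
  Set.inter_subset_inter_left _ (Sect2.lamPlaqs_subset_printedPlaqs Ω k hΩ 0)

variable (av Ω Ω₀ k δ W) in
/-- **★ PRINT'S DATA HYPOTHESIS (7) UNDER (α) FOR THE TOP DOMAIN `Ω₀`**: level 0 — `W 0` on `Sect2.lamPlaqsTop Ω Ω₀ k`; level `m+1 ≤ k` — the clause of `Sect2.DataSmall7Lam` verbatim.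
`↔ Sect2.DataSmall7Lam` at `Ω₀ = univ`; antitone in `Ω₀`; implied by `Record12BgRowTopDomain`'s `Sect2.DataSmall7PTop` (★ `Sect2.DataSmall7PTop.toLamTop`).
-- TODO(general form): (7) for an arbitrary admissible `𝔅_k` of [6] Sect. A; here a (2.18) index and a top domain `Ω₀`.
[cite: Balaban1985Variational, (3),(7) p.278 L20–33; Balaban1984PropagatorsII, (2.3) p.224; Balaban1985RegularSpaces, (1.3)–(1.9) p.77; Balaban1988Convergent, p.255, (2.10)–(2.12) p.256] -/
def Sect2.DataSmall7LamTop : Prop :=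
  PlaqSmallOn (Sect2.lamPlaqsTop Ω Ω₀ k) (δ 0) (W 0) ∧
    ∀ m, m + 1 ≤ k → PlaqSmallOn (Sect2.lamPlaqs Ω k (m + 1)) (δ (m + 1)) (Sect2.mixedFieldB av (lamBondsSeq Ω k (m + 1)) (W (m + 1)) (W m))

/-- (7) on `Λ` over the whole torus GIVES (7) for any top domain. [cite: Balaban1985Variational, (7) p.278 (bookkeeping)] -/
theorem Sect2.DataSmall7Lam.toTop (Ω₀ : Set (Site P 0)) (h : Sect2.DataSmall7Lam av Ω k δ W) : Sect2.DataSmall7LamTop av Ω Ω₀ k δ W :=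
  ⟨fun p hp => h.1 p (Sect2.lamPlaqsTop_subset Ω Ω₀ k hp), h.2⟩

/-- The level-0 clause. [cite: Balaban1985Variational, (7) p.278 (bookkeeping)] -/
theorem Sect2.DataSmall7LamTop.zero (h : Sect2.DataSmall7LamTop av Ω Ω₀ k δ W) : PlaqSmallOn (Sect2.lamPlaqsTop Ω Ω₀ k) (δ 0) (W 0) := h.1

/-- The level-`(m+1)` clause (`spliceAtB` spelling). [cite: Balaban1985Variational, (7) p.278 (bookkeeping)] -/
theorem Sect2.DataSmall7LamTop.succ (h : Sect2.DataSmall7LamTop av Ω Ω₀ k δ W) {m : ℕ} (hm : m + 1 ≤ k) :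
    PlaqSmallOn (Sect2.lamPlaqs Ω k (m + 1)) (δ (m + 1)) (spliceAtB (lamBondsSeq Ω k (m + 1)) (W (m + 1)) ((av m).avg (W m))) := h.2 m hm

/-- (7) for the top domain FROM ITS TWO CLAUSES (`spliceAtB` spelling). [cite: Balaban1985Variational, (7) p.278 (bookkeeping)] -/
theorem Sect2.DataSmall7LamTop.of_spliceAtB (h0 : PlaqSmallOn (Sect2.lamPlaqsTop Ω Ω₀ k) (δ 0) (W 0))
    (hsucc : ∀ m, m + 1 ≤ k → PlaqSmallOn (Sect2.lamPlaqs Ω k (m + 1)) (δ (m + 1)) (spliceAtB (lamBondsSeq Ω k (m + 1)) (W (m + 1)) ((av m).avg (W m)))) :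
    Sect2.DataSmall7LamTop av Ω Ω₀ k δ W := ⟨h0, hsucc⟩

/-- Weakening the thresholds. [cite: Balaban1985Variational, (7) p.278 (bookkeeping)] -/
theorem Sect2.DataSmall7LamTop.of_le (h : Sect2.DataSmall7LamTop av Ω Ω₀ k δ W) (hδ : ∀ n, n ≤ k → δ n ≤ δ' n) : Sect2.DataSmall7LamTop av Ω Ω₀ k δ' W :=
  ⟨fun p hp => (h.1 p hp).trans_le (hδ 0 (Nat.zero_le _)), fun m hm p hp => (h.2 m hm p hp).trans_le (hδ (m + 1) hm)⟩

/-- ANTITONE in the top domain. [cite: Balaban1985Variational, (7) p.278 (bookkeeping)] -/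
theorem Sect2.DataSmall7LamTop.anti (h : Sect2.DataSmall7LamTop av Ω Ω₀ k δ W) (hΩ : Ω₀' ⊆ Ω₀) : Sect2.DataSmall7LamTop av Ω Ω₀' k δ W :=
  ⟨fun p hp => h.1 p (Sect2.lamPlaqsTop_mono Ω k hΩ hp), h.2⟩

variable (av Ω k δ W) in
/-- At `Ω₀ = T_η` the top-domain (7) IS `Sect2.DataSmall7Lam`. [cite: Balaban1985Variational, (7) p.278; Balaban1985RegularSpaces, (1.3) p.77] -/
theorem Sect2.dataSmall7LamTop_univ_iff : Sect2.DataSmall7LamTop av Ω Set.univ k δ W ↔ Sect2.DataSmall7Lam av Ω k δ W := by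
  unfold Sect2.DataSmall7LamTop Sect2.DataSmall7Lam
  rw [Sect2.lamPlaqsTop_univ]

/-- ★ **THE RECORD'S TOP-DOMAIN (7) (`Sect2.DataSmall7PTop`, reading (b) on the data side) GIVES PRINT'S** — for an index with `Ω_{k+1} = ∅`, saturated regions, standing range: the record's
data hypothesis is the STRONGER one (more plaquettes), so every theorem displaying `Sect2.DataSmall7LamTop` applies to every datum the record admits.
[cite: Balaban1985Variational, (3),(7) p.278 L20–33; Balaban1984PropagatorsII, (2.3) p.224] -/
theorem Sect2.DataSmall7PTop.toLamTop (hk : k ≤ P.m + P.K) (hΩ : Ω (k + 1) = ∅)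
    (hsat : ∀ (j : ℕ) (x x' : Site P 0), 1 ≤ j → j ≤ k → iterBlockOf j x = iterBlockOf j x' → x ∈ Ω j → x' ∈ Ω j) (h : Sect2.DataSmall7PTop av Ω Ω₀ k δ W) :
    Sect2.DataSmall7LamTop av Ω Ω₀ k δ W := by
  refine ⟨fun p hp => h.1 p (Sect2.lamPlaqsTop_subset_printedPlaqsTop Ω Ω₀ k hΩ hp), fun m hm => ?_⟩
  -- the level-`(m+1)` clause: (b) smallness on `printedPlaqs ⊇ lamPlaqs`, then the splice dictionary of §3 (or equality of the fields at the top)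
  have hb : PlaqSmallOn (Sect2.lamPlaqs Ω k (m + 1)) (δ (m + 1)) (Sect2.mixedField av (genSet Ω k (m + 1)) (W (m + 1)) (W m)) :=
    fun p hp => h.2 m hm p (Sect2.lamPlaqs_subset_printedPlaqs Ω k hΩ (m + 1) hp)
  rcases hm.lt_or_eq with hmk | hmk
  · exact (Sect2.plaqSmallOn_lamPlaqs_mixedFieldB_iff av Ω (by omega) hmk (fun x x' => hsat (m + 1 + 1) x x' (by omega) (by omega)) _ _ _).2 hb
  · rw [Sect2.mixedFieldB_lamBondsSeq_of_le av Ω hmk.ge]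
    exact hb

end DataLamTop

end Literature.MathematicalPhysics.QuantumFieldTheory.Balaban1983to89.Node00

end
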